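import Summits.QuantumFields.QCD.Theses.NestedDissectionSea

/-!
# Route `NestedDissectionSea` — Assembly (item stmt-QuantumFields-13881)

The assembly item of route `NestedDissectionSea` (rev ≥ 11) is the four-hypothesis deciding chain

  `RobustYangMills → CoerciveSea → SeaFactorisationBridge → ThresholdShift → QCD`,

which is verbatim the type of the route's gate-checked deciding theorem
`Summit.QuantumFields.QCD.Theses.NestedDissectionSea.closes` (pure logic, standard axioms): the bridge
applied to robust SU(3) Yang–Mills and the coercive-sea hinge returns, for `N_f = 2, 3`, the threshold form
of `QCDOf N_f` (`∃ M₀ ≥ 0, ∃ reg, reg.HasMassScaling ∧ ∀ m > M₀, …`); `ThresholdShift N_f reg M₀` re-bases the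
critical mass (`reg'.scheme m = reg.scheme (m + M₀)`, `HasMassScaling` transported), so every positive mass
tuple `m` is served at `m + M₀ > M₀`; and `QCD = QCDOf 2 ∧ QCDOf 3`.

* `NestedDissectionSea.assembly_proof` — the route decl `Assembly`, literally; proof `exact closes` after
  unfolding. (Bookkeeping: this module imports the route module, so the gate records the closure as the
  docstring link `proved by …` rather than an in-file `Assembly_holds`, cf. docs/reference/gate.md §4.2.)

## Rev 26 (item stmt-QuantumFields-17704, route-repair 2026-08-16 after the `QCDOf` re-type `IsChiralAtZero`)

The assembly item is now the seven-hypothesis deciding chain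

  `RobustYangMillsRG → EarlyCrosserLaw → SignDefectForcesCrossing → DiluteOfEarlyCrossers →
   CoerciveOfDilute → SeaFactorisationBridge → JumpLineIsChiral → QCD`

(no threshold re-basing: `ThresholdShift` and the rev-11 chain are retired), again verbatim the type of the
route's current deciding theorem `closes`.

* `NestedDissectionSea.assembly_rev26_proof` — the route decl `Assembly` (rev 26), literally; proof
  `exact closes` after unfolding.

## Rev 29 (item stmt-QuantumFields-18067, route-repair 2026-08-17 after the crux-attack rattack-17705)

The assembly item is now the seven-hypothesis deciding chain

  `RobustYangMillsRG → EarlyCrosserLaw → SignDefectForcesCrossing → DiluteOfEarlyCrossers →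
   CoerciveOfDilute → SeaFactorisationBridge → LightQuarkCompletion → QCD`

(the bridge is back in THRESHOLD form, returning one admissible regularisation with a threshold `M₀ ≥ 0`,
the two-sided parity pin and the `QCDOf` body above `M₀`; the light-quark node `LightQuarkCompletion`
— split as `ZeroThresholdDescent ∧ JumpLineIsChiral` — descends to zero threshold and supplies
`IsChiralAtZero`), once more verbatim the type of the route's current deciding theorem `closes`.

* `NestedDissectionSea.assembly_rev29_proof` — the route decl `Assembly` (rev 29), literally; proof
  `exact closes` after unfolding.

## Rev 31 (item stmt-QuantumFields-16993, route-repair 2026-08-17 on rattack-18065, slot-freeing step 2/3)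

The assembly item is now the six-hypothesis INTERIM deciding chain

  `RobustYangMillsRG → EarlyCrosserLaw → SignDefectForcesCrossing → CoerciveOfDilute →
   SeaFactorisationBridge → LightQuarkCompletion → QCD`

— the rev-29 chain with the proved pure-logic support `DiluteOfEarlyCrossers` dropped (to free the 15th
item slot) and its content (`EarlyCrosserLaw → SignDefectForcesCrossing → NegativeCellsDilute`) inlined
into the body of `closes`; again verbatim the type of the route's current deciding theorem `closes`.

* `NestedDissectionSea.assembly_rev31_proof` — the route decl `Assembly` (rev 31), literally; proof
  `exact closes` after unfolding.
-/

namespace Summit.QuantumFields.QCD.Theorems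

/-- **Assembly of route NestedDissectionSea** (item stmt-QuantumFields-13881):
`RobustYangMills → CoerciveSea → SeaFactorisationBridge → ThresholdShift → QCD`.
This is literally the statement of the route's deciding theorem
`Summit.QuantumFields.QCD.Theses.NestedDissectionSea.closes` (bridge fed with robust Yang–Mills and the
coercive sea gives the threshold form of `QCDOf 2 ∧ QCDOf 3`; the audit-g7 shift `ThresholdShift` absorbs
the threshold `M₀` into `m_crit`; `QCD = QCDOf 2 ∧ QCDOf 3`), so the proof is `exact closes`. -/
theorem NestedDissectionSea.assembly_proof :
    Summit.QuantumFields.QCD.Theses.NestedDissectionSea.Assembly := by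
  unfold Summit.QuantumFields.QCD.Theses.NestedDissectionSea.Assembly
  exact Summit.QuantumFields.QCD.Theses.NestedDissectionSea.closes

/-- **Assembly of route NestedDissectionSea, rev 26** (item stmt-QuantumFields-17704, route-repair
2026-08-16 after the `QCDOf` re-type `IsChiralAtZero`): the seven-hypothesis deciding chain
`RobustYangMillsRG → EarlyCrosserLaw → SignDefectForcesCrossing → DiluteOfEarlyCrossers →
CoerciveOfDilute → SeaFactorisationBridge → JumpLineIsChiral → QCD`.
THE LINE `EarlyCrosserLaw` gives windowed dilution + pin (`NegativeCellsDilute`) through the supports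
`SignDefectForcesCrossing` and `DiluteOfEarlyCrossers`; the separator-Wegner completion `CoerciveOfDilute`
gives the hinge `CoerciveSea`; the restated bridge fed with the RG-level robust SU(3) Yang–Mills input
returns, for `N_f = 2, 3`, one admissible branch regularisation pinned at zero threshold to the
parity-jump line and carrying the `QCDOf` body at every positive mass tuple; `JumpLineIsChiral` turns the
pin into `reg.IsChiralAtZero`; `QCD = QCDOf 2 ∧ QCDOf 3`. The route decl `Assembly` is, by construction
(D-0027 §2.1), verbatim the type of the route's gate-checked deciding theorem
`Summit.QuantumFields.QCD.Theses.NestedDissectionSea.closes` (pure logic, standard axioms), so after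
unfolding the proof is `exact closes`. (The earlier decl `NestedDissectionSea.assembly_proof` above closed
the rev-11 item stmt-QuantumFields-13881 by the same one-liner; its docstring describes the retired
four-hypothesis chain.) -/
theorem NestedDissectionSea.assembly_rev26_proof :
    Summit.QuantumFields.QCD.Theses.NestedDissectionSea.Assembly := by
  unfold Summit.QuantumFields.QCD.Theses.NestedDissectionSea.Assembly
  exact Summit.QuantumFields.QCD.Theses.NestedDissectionSea.closes

/-- **Assembly of route NestedDissectionSea, rev 29** (item stmt-QuantumFields-18067, route-repair
2026-08-17 after the crux-attack rattack-17705): the seven-hypothesis deciding chain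
`RobustYangMillsRG → EarlyCrosserLaw → SignDefectForcesCrossing → DiluteOfEarlyCrossers →
CoerciveOfDilute → SeaFactorisationBridge → LightQuarkCompletion → QCD`.
THE LINE `EarlyCrosserLaw` gives windowed dilution + pin (`NegativeCellsDilute`) through the two proved
supports `SignDefectForcesCrossing` and `DiluteOfEarlyCrossers`; the separator-Wegner completion
`CoerciveOfDilute` gives the hinge `CoerciveSea`; the THRESHOLD bridge `SeaFactorisationBridge`, fed with
the RG-level robust SU(3) Yang–Mills input `RobustYangMillsRG`, returns for `N_f = 2, 3` one admissible
regularisation with a threshold `M₀ ≥ 0`, the two-sided parity pin above `M₀` and the `QCDOf` body above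
`M₀`; the light-quark node `LightQuarkCompletion` (= `ZeroThresholdDescent ∧ JumpLineIsChiral` by its
split glue) turns it into a branch regularisation pinned at zero threshold, chiral at zero
(`IsChiralAtZero`) and carrying the body at every positive mass tuple — the witness of `QCDOf N_f`; and
`QCD = QCDOf 2 ∧ QCDOf 3`. The route decl `Assembly` is, by construction (D-0027 §2.1), verbatim the type
of the route's gate-checked deciding theorem `Summit.QuantumFields.QCD.Theses.NestedDissectionSea.closes`
(pure logic, standard axioms), so after unfolding the proof is `exact closes`. (The two earlier decls
above closed the rev-11 item stmt-QuantumFields-13881 and the rev-26 item stmt-QuantumFields-17704 by the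
same one-liner; their docstrings describe the retired chains.) -/
theorem NestedDissectionSea.assembly_rev29_proof :
    Summit.QuantumFields.QCD.Theses.NestedDissectionSea.Assembly := by
  unfold Summit.QuantumFields.QCD.Theses.NestedDissectionSea.Assembly
  exact Summit.QuantumFields.QCD.Theses.NestedDissectionSea.closes

/-- **Assembly of route NestedDissectionSea, rev 31** (item stmt-QuantumFields-16993, route-repair
2026-08-17 on the crux-attack rattack-18065, slot-freeing step 2/3): the six-hypothesis INTERIM
deciding chain
`RobustYangMillsRG → EarlyCrosserLaw → SignDefectForcesCrossing → CoerciveOfDilute →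
SeaFactorisationBridge → LightQuarkCompletion → QCD`.
THE LINE `EarlyCrosserLaw` gives windowed dilution + pin (`NegativeCellsDilute`) pointwise through the
proved support `SignDefectForcesCrossing` (the former pure-logic support `DiluteOfEarlyCrossers`,
`EarlyCrosserLaw → SignDefectForcesCrossing → NegativeCellsDilute`, is dropped from the item list and its
content inlined into the body of `closes`); the by-name separator-Wegner glue `CoerciveOfDilute`
(`NegativeCellsDilute → CoerciveSea`) gives the hinge `CoerciveSea`; the THRESHOLD bridge
`SeaFactorisationBridge`, fed with the RG-level robust SU(3) Yang–Mills input `RobustYangMillsRG`, returns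
for `N_f = 2, 3` one admissible regularisation with a threshold `M₀ ≥ 0`, the two-sided parity pin above
`M₀` and the `QCDOf` body above `M₀`; the light-quark node `LightQuarkCompletion` turns it into a
regularisation with mass scaling, chiral at zero (`IsChiralAtZero`) and carrying the body at every
positive mass tuple — the witness of `QCDOf N_f`; and `QCD = QCDOf 2 ∧ QCDOf 3`. The route decl
`Assembly` is, by construction (D-0027 §2.1), verbatim the type of the route's gate-checked deciding
theorem `Summit.QuantumFields.QCD.Theses.NestedDissectionSea.closes` (pure logic, standard axioms), so
after unfolding the proof is `exact closes`. (The three earlier decls above closed the rev-11 item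
stmt-QuantumFields-13881, the rev-26 item stmt-QuantumFields-17704 and the rev-29 item
stmt-QuantumFields-18067 by the same one-liner; their docstrings describe the retired chains.) -/
theorem NestedDissectionSea.assembly_rev31_proof :
    Summit.QuantumFields.QCD.Theses.NestedDissectionSea.Assembly := by
  unfold Summit.QuantumFields.QCD.Theses.NestedDissectionSea.Assembly
  exact Summit.QuantumFields.QCD.Theses.NestedDissectionSea.closes

end Summit.QuantumFields.QCD.Theorems
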